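import Summits.KontsevichZagierPeriods.KontsevichZagierPeriods.Theorems.SymplecticScissorsVolumeFormOffPlaneLogBoxLinear

/-!
# Crux `VolumeFormOffPlane` (stmt-KontsevichZagierPeriods-14935) — line `Sketch`,
stub `stub_orderCellPerm` (relabelling the box coordinates of an order cell)

Box-dimension `n`: box coordinates `x_ι = p (Fin.castSucc ι)` and slack `z = p (Fin.last n)`
subject to `0 < z ∧ z · ∏ x_ι < 1`. For `g : ℝ` and a permutation `σ` of `Fin n` the ORDER CELL is
`O_σ(g) = {StrictMono (ι ↦ x_{σ ι})} ∩ {1 < x_ι < g} ∩ {0 < z, z · ∏ x_ι < 1}`.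
For integrand-`1` representations `r` on `O_id(g)` and `r'` on `O_σ(g)` we show
`[r] − [r'] ∈ KZ.relations`: reindex `r` along the permutation `e` of `Fin (n + 1)` extending `σ`
and fixing the slack coordinate (`KZ.IntegralRep.reindex`, one rule-(2) move with `|det| = 1`,
`KZ.of_sub_of_reindex_mem_relations`); the reindexed domain `{w | w ∘ e ∈ O_id(g)}` is literally
`O_σ(g)` (the cube and the product `∏ x_ι` are `σ`-invariant, `Equiv.prod_comp`), so the second
step is the identity move between two representations with the same domain and integrand `1` on it
(`KZ.of_sub_of_mem_relations_of_eqOn`). The bookkeeping copies `lbl_perm`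
(`SymplecticScissorsVolumeFormOffPlaneLogBoxLinear`).

Sources: M. Kontsevich, D. Zagier, *Periods* (2001), §1.2 rules (1), (2). Folklore bookkeeping.
-/

noncomputable section

open MeasureTheory Set
open Literature.NumberTheory.Transcendental

namespace Summit.KontsevichZagierPeriods.SymplecticScissors.LogPolytope

/-! ## The permutation of `Fin (n + 1)` extending `σ` and fixing the last coordinate -/

/-- The permutation of `Fin (n + 1)` extending `σ : Equiv.Perm (Fin n)` on the box coordinates and
fixing the last (slack) coordinate sends `castSucc j` to `castSucc (σ j)`. [folklore] -/
theorem ocp_extend_castSucc {n : ℕ} (σ : Equiv.Perm (Fin n)) (j : Fin n) :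
    (finSuccEquivLast.trans ((Equiv.optionCongr σ).trans finSuccEquivLast.symm))
      (Fin.castSucc j) = Fin.castSucc (σ j) := by
  simp only [Equiv.trans_apply, finSuccEquivLast_castSucc, Equiv.optionCongr_apply,
    Option.map_some, finSuccEquivLast_symm_some]

/-- The permutation of `Fin (n + 1)` extending `σ : Equiv.Perm (Fin n)` on the box coordinates and
fixing the last (slack) coordinate fixes `Fin.last n`. [folklore] -/
theorem ocp_extend_last {n : ℕ} (σ : Equiv.Perm (Fin n)) :
    (finSuccEquivLast.trans ((Equiv.optionCongr σ).trans finSuccEquivLast.symm))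
      (Fin.last n) = Fin.last n := by
  simp only [Equiv.trans_apply, finSuccEquivLast_last, Equiv.optionCongr_apply,
    Option.map_none, finSuccEquivLast_symm_none]

/-! ## The stub -/

/-- **Stub (relabelling the box coordinates of an order cell is a relation).** For a permutation
`σ` of `Fin n`, the integrand-`1` representations on the order cells `O_id(g)` (box coordinates
increasing) and `O_σ(g)` (box coordinates increasing along `σ`) satisfy
`[r] − [r'] ∈ KZ.relations`: reindex `r` along the permutation of `Fin (n + 1)` extending `σ` and
fixing the slack coordinate (rule (2), `|det| = 1`), whose reindexed domain is exactly `O_σ(g)`,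
then compare two representations with the same domain and integrand `1` on it (rule (1)).
[folklore] -/
theorem stub_orderCellPerm : (∀ (n : ℕ) (g : ℝ) (σ : Equiv.Perm (Fin n)) (r r' : KZ.IntegralRep (n + 1)), r.domain = {p : Fin ((n) + 1) → ℝ | StrictMono (fun ι : Fin (n) => p (Fin.castSucc ι)) ∧ (∀ ι : Fin (n), 1 < p (Fin.castSucc ι) ∧ p (Fin.castSucc ι) < g) ∧ 0 < p (Fin.last (n)) ∧ p (Fin.last (n)) * ∏ ι : Fin (n), p (Fin.castSucc ι) < 1} → r'.domain = {p : Fin ((n) + 1) → ℝ | StrictMono (fun ι : Fin (n) => p (Fin.castSucc (σ ι))) ∧ (∀ ι : Fin (n), 1 < p (Fin.castSucc ι) ∧ p (Fin.castSucc ι) < g) ∧ 0 < p (Fin.last (n)) ∧ p (Fin.last (n)) * ∏ ι : Fin (n), p (Fin.castSucc ι) < 1} → (∀ p ∈ r.domain, r.integrand p = 1) → (∀ p ∈ r'.domain, r'.integrand p = 1) → KZ.of r - KZ.of r' ∈ KZ.relations) := by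
  intro n g σ r r' hr hr' hri hri'
  -- adapted from `lbl_perm`: the permutation of `Fin (n + 1)` extending `σ`, fixing the slack
  obtain ⟨e, he⟩ : ∃ e : Equiv.Perm (Fin (n + 1)),
      e = finSuccEquivLast.trans ((Equiv.optionCongr σ).trans finSuccEquivLast.symm) :=
    ⟨_, rfl⟩
  have hes : ∀ j : Fin n, e (Fin.castSucc j) = Fin.castSucc (σ j) := fun j => by
    rw [he, ocp_extend_castSucc]
  have hel : e (Fin.last n) = Fin.last n := by rw [he, ocp_extend_last]
  have hd : r'.domain = (r.reindex e).domain := by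
    rw [KZ.IntegralRep.reindex_domain, hr, hr']
    ext w
    simp only [mem_setOf_eq, hes, hel]
    rw [Equiv.prod_comp σ (fun j => w (Fin.castSucc j))]
    refine and_congr_right fun _ => and_congr_left fun _ => ⟨fun h j => ?_, fun h j => ?_⟩
    · exact h (σ j)
    · simpa using h (σ.symm j)
  have h1 : KZ.of r - KZ.of (r.reindex e) ∈ KZ.relations := KZ.of_sub_of_reindex_mem_relations r e
  have h2 : KZ.of (r.reindex e) - KZ.of r' ∈ KZ.relations := by
    refine KZ.of_sub_of_mem_relations_of_eqOn hd fun w hw => ?_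
    rw [KZ.IntegralRep.reindex_integrand]
    exact (hri _ hw).trans (hri' w (hd ▸ hw)).symm
  have : KZ.of r - KZ.of r' =
      (KZ.of r - KZ.of (r.reindex e)) + (KZ.of (r.reindex e) - KZ.of r') := by abel
  rw [this]
  exact KZ.relations.add_mem h1 h2

end Summit.KontsevichZagierPeriods.SymplecticScissors.LogPolytope
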